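import Literature.Geometry.Lorentzian.KerrStarChartBounds
import Literature.Geometry.Lorentzian.KerrSchildWaveCauchyProblem
import Literature.Geometry.Lorentzian.KerrWaveEnergyProofs
import HarnessLib

/-!
# Uniform `C¹` bounds for the surgered Kerr–Schild background `Kerr.surgeryBackground`

(family `gr`; infrastructure for *uniform* energy estimates on the Kerr chart; namespace
`Literature.Geometry.Lorentzian.Kerr`)

`KerrSchildWaveCauchyProblem.lean` extends the Kerr chart metric `g_{M,a} = η + 2H ℓ ⊗ ℓ` on
`{r > r₀}` (`r₀ > 0`, `M ≥ 0`) to a generalised Kerr–Schild background on all of `ℝ⁴`,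
`Kerr.surgeryBackground M a r₀`, with profile `φ = 2 χ_{r₀}(r) H` (`Kerr.surgeryProfile`) and null
vector `ℓ♯ = Kerr.nullVector a`; its inverse metric is `g^{μν} = η^{μν} − φ ℓ^μ ℓ^ν`. The energy
estimate of `KerrSchildEnergyEstimate.lean` has a constant `e^{(1 + 192 (1 + Φ) D) T}` governed by a
bound `D` for the first derivatives `|∂_μ g^{αβ}|` on the region swept out by the wave. This file
proves that **one bound `D = D(M, a, r₀)` works on all of `ℝ⁴`**
(`Kerr.exists_bound_fderiv_surgeryBackground_inverseMetric`), so that energy estimates on the Kerr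
exterior hold with constants independent of the support of the data (consumed by
`Literature/Barriers/FinalStateConjecture/TrappingDerivativeLossEnergy.lean` to derive the named
fact `KerrWaveCauchyEnergyEstimate` from `KerrSchild.waveCauchyProblem`).

## Proof

* *Stationarity*: no component depends on `t*` (`radius`, `scalarH`, `nullVector` are invariant
  under `x ↦ x + t ∂_{t*}`, `KerrSchildCoord.lean`), so `g^{αβ}(x) = g^{αβ}(0, x⃗)` and every
  coordinate derivative is a derivative of the leaf function `y ↦ g^{αβ}(0, y)` along a vector of
  norm `≤ 1`.
* *Inside* `{r < r₀/2}` the profile vanishes identically, so the leaf function is locally the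
  constant `η^{αβ}`.
* *On the slice* `{r > r₀/4}` the leaf function is differentiable with uniformly bounded
  derivative: `‖∇r‖ ≤ 1 + 4|a|/r₀` and `‖D ℓ⃗‖ ≤ (21 (1 + 4|a|/r₀) + 5)/(r₀/4)`
  (`KerrStarChartBounds.lean`), `H = M r/Σ` with `Σ = 2r² − ‖y‖² + a² ≥ r²` and `‖y‖ ≤ r + |a|`
  give `‖DH‖ ≤ M (5 (1 + 4|a|/r₀) + 2 + 8|a|/r₀)/(r₀/4)²` (`exists_hasFDerivAt_scalarH_slice`), the
  cutoff `χ_{r₀} = σ(2r/r₀ − 1)` (Mathlib's `Real.smoothTransition`, whose derivative is bounded,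
  `Kerr.exists_bound_deriv_smoothTransition` of `KerrWaveEnergyProofs.lean`) contributes
  `‖D(χ∘r)‖ ≤ C_σ (2/r₀)(1 + 4|a|/r₀)`, and
  `0 ≤ φ ≤ 4M/r₀`, `|ℓ^μ| ≤ 1` (`KerrSchildWaveCauchyProblem.lean`, `KerrEnergyIdentity.lean`).

Only the existence of a bound matters downstream; the constant `Kerr.surgeryDerivBound` is
explicit but not optimised.

## References

* R. P. Kerr, A. Schild, 1965, §2 (the Kerr–Schild form) (key `KerrSchild1965`).
* M. Visser, *The Kerr spacetime: a brief introduction*, arXiv:0706.0622, (33)–(35) (key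
  `arXiv07060622`).
* J. Sbierski, Anal. PDE 8 (2015), §2, Thm. 2.1 (the uniformity condition `|∇N| ≤ C` under which
  the energy estimate has a uniform constant) (key `Sbierski2015`).
-/

noncomputable section

open Set Filter
open scoped Topology

namespace Literature.Geometry.Lorentzian.Kerr

/-! ### The derivative of the cutoff -/

/-- The derivative of the radial cutoff `χ_{r₀}(s) = σ(2s/r₀ − 1)`:
`χ' = σ'(2s/r₀ − 1) · (2/r₀)`. [folklore] -/
theorem hasDerivAt_innerCutoff (r₀ s : ℝ) :
    HasDerivAt (innerCutoff r₀) (deriv Real.smoothTransition (2 * s / r₀ - 1) * (2 / r₀)) s := by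
  have hσ : HasDerivAt Real.smoothTransition (deriv Real.smoothTransition (2 * s / r₀ - 1))
      (2 * s / r₀ - 1) :=
    ((Real.smoothTransition.contDiff (n := 1)).differentiable one_ne_zero _).hasDerivAt
  have hin : HasDerivAt (fun s : ℝ ↦ 2 * s / r₀ - 1) (2 / r₀) s := by
    have := (((hasDerivAt_id s).const_mul 2).div_const r₀).sub_const 1
    simpa using this
  exact hσ.comp s hin

/-! ### Stationarity of the surgered background -/

/-- The cutoff profile `φ = 2χ(r)H` does not depend on `t*`. [cite: KerrSchild1965, §2] -/
theorem surgeryProfile_add_smul_basisVector_zero (M a r₀ : ℝ) (x : E4) (t : ℝ) :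
    surgeryProfile M a r₀ (x + t • E4.basisVector 0) = surgeryProfile M a r₀ x := by
  simp only [surgeryProfile, radius_add_time_smul_basisVector, scalarH_add_smul_basisVector_zero]

/-- **Stationarity of the surgered background**: its inverse metric does not depend on `t*`.
[cite: KerrSchild1965, §2] -/
theorem surgeryBackground_inverseMetric_add_smul_basisVector_zero {M : ℝ} (hM : 0 ≤ M) (a : ℝ)
    {r₀ : ℝ} (hr₀ : 0 < r₀) (x : E4) (t : ℝ) (α β : Fin 4) :
    (surgeryBackground M a r₀ hM hr₀).inverseMetric (x + t • E4.basisVector 0) α β =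
      (surgeryBackground M a r₀ hM hr₀).inverseMetric x α β := by
  simp only [KerrSchild.Background.inverseMetric, surgeryBackground_φ, surgeryBackground_l,
    KerrSchild.inverseMetric, surgeryProfile_add_smul_basisVector_zero,
    nullVector_add_smul_basisVector_zero]

/-- The inverse metric of the surgered background is a function of the spatial coordinates:
`g^{αβ}(x) = g^{αβ}(0, x⃗)`. [cite: KerrSchild1965, §2] -/
theorem surgeryBackground_inverseMetric_eq_leaf {M : ℝ} (hM : 0 ≤ M) (a : ℝ) {r₀ : ℝ}
    (hr₀ : 0 < r₀) (x : E4) (α β : Fin 4) :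
    (surgeryBackground M a r₀ hM hr₀).inverseMetric x α β =
      (surgeryBackground M a r₀ hM hr₀).inverseMetric (E4.ofTimeSpace 0 (E4.spatial x)) α β := by
  have hx : x = E4.ofTimeSpace 0 (E4.spatial x) + E4.time x • E4.basisVector 0 := by
    conv_lhs => rw [← E4.ofTimeSpace_time_spatial x]
    rw [E4.ofTimeSpace_eq_smul_add', E4.spaceEmbed_apply, add_comm]
  conv_lhs => rw [hx]
  exact surgeryBackground_inverseMetric_add_smul_basisVector_zero hM a hr₀ _ _ α β

/-! ### Derivative bounds on the slice `{r > ρ}` -/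

section Slice

variable {M a ρ : ℝ} {y : E3}

/-- On the slice `{r > ρ}`, `ρ > 0`: `H` as a function of `y` is differentiable with
**`‖DH‖ ≤ M (5 (1 + |a|/ρ) + 2 + 2|a|/ρ)/ρ²`** (`H = M r/Σ`, `Σ = 2r² − ‖y‖² + a² ≥ r²`,
`‖∇r‖ ≤ 1 + |a|/ρ`, `‖y‖ ≤ r + |a|`). Visser arXiv:0706.0622, (33) for the formula `H = M r/Σ`.
[cite: arXiv07060622, (33)] -/
theorem exists_hasFDerivAt_scalarH_slice (hM : 0 ≤ M) (hρ : 0 < ρ) (hy : y ∈ slice a ρ) :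
    ∃ H' : E3 →L[ℝ] ℝ, HasFDerivAt (fun y ↦ scalarH M a (E4.ofTimeSpace 0 y)) H' y ∧
      ‖H'‖ ≤ M * (5 * (1 + |a| / ρ) + 2 + 2 * |a| / ρ) / ρ ^ 2 := by
  have hr : 0 < radius a (E4.ofTimeSpace 0 y) := radius_pos_of_mem_slice hy
  have hρr : ρ < radius a (E4.ofTimeSpace 0 y) := lt_radius_of_mem_slice hy
  set r : ℝ := radius a (E4.ofTimeSpace 0 y) with hrdef
  set K : ℝ := 1 + |a| / ρ with hK
  have hK0 : 0 ≤ K := by positivity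
  have hdr := hasFDerivAt_radius_slice hr
  have hdrn : ‖radiusGrad a y‖ ≤ K := norm_radiusGrad_le hρ hy
  have hSgpos : 0 < blSigma a y := blSigma_pos hr
  have hSgr : r ^ 2 ≤ blSigma a y := sq_le_blSigma hr
  have hyn : ‖y‖ ≤ r + |a| := norm_le_radius_add_abs hr
  -- `Σ` and its derivative
  have hnsq : HasFDerivAt (fun y' : E3 ↦ ‖y'‖ ^ 2) (2 • (innerSL ℝ y : E3 →L[ℝ] ℝ)) y :=
    (hasStrictFDerivAt_norm_sq y).hasFDerivAt
  have hSg : HasFDerivAt (blSigma a)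
      ((2 : ℝ) • (r • radiusGrad a y + r • radiusGrad a y) - 2 • (innerSL ℝ y : E3 →L[ℝ] ℝ)) y := by
    have h := (((hdr.mul hdr).const_mul (2 : ℝ)).sub hnsq).add_const (a ^ 2)
    refine h.congr_of_eventuallyEq (Eventually.of_forall fun y' ↦ ?_)
    simp only [blSigma, Pi.mul_apply, Pi.sub_apply, pow_two]
  have hSgn : ‖(2 : ℝ) • (r • radiusGrad a y + r • radiusGrad a y) -
      2 • (innerSL ℝ y : E3 →L[ℝ] ℝ)‖ ≤ 4 * r * K + 2 * (r + |a|) := by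
    have h1 : ‖(2 : ℝ) • (r • radiusGrad a y + r • radiusGrad a y)‖ ≤ 4 * r * K := by
      rw [norm_smul, Real.norm_eq_abs, abs_two]
      have : ‖r • radiusGrad a y + r • radiusGrad a y‖ ≤ r * K + r * K := by
        refine (norm_add_le _ _).trans (add_le_add ?_ ?_) <;>
        · rw [norm_smul, Real.norm_eq_abs, abs_of_pos hr]
          exact mul_le_mul_of_nonneg_left hdrn hr.le
      linarith
    have h2 : ‖2 • (innerSL ℝ y : E3 →L[ℝ] ℝ)‖ ≤ 2 * (r + |a|) := by
      calc ‖2 • (innerSL ℝ y : E3 →L[ℝ] ℝ)‖ ≤ (2 : ℕ) * ‖(innerSL ℝ y : E3 →L[ℝ] ℝ)‖ := norm_nsmul_le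
        _ = 2 * ‖y‖ := by rw [innerSL_apply_norm]; norm_num
        _ ≤ 2 * (r + |a|) := by linarith
    exact (norm_sub_le _ _).trans (add_le_add h1 h2)
  -- `Σ⁻¹` and `M r Σ⁻¹`
  have hinv : HasFDerivAt (fun y' : E3 ↦ (blSigma a y')⁻¹)
      ((-(blSigma a y ^ 2)⁻¹) • ((2 : ℝ) • (r • radiusGrad a y + r • radiusGrad a y) -
        2 • (innerSL ℝ y : E3 →L[ℝ] ℝ))) y :=
    (hasDerivAt_inv hSgpos.ne').comp_hasFDerivAt y hSg
  have hform : HasFDerivAt (fun y' : E3 ↦ M * radius a (E4.ofTimeSpace 0 y') * (blSigma a y')⁻¹)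
      ((M * r) • ((-(blSigma a y ^ 2)⁻¹) • ((2 : ℝ) • (r • radiusGrad a y + r • radiusGrad a y) -
        2 • (innerSL ℝ y : E3 →L[ℝ] ℝ))) + (blSigma a y)⁻¹ • (M • radiusGrad a y)) y :=
    (hdr.const_mul M).mul hinv
  -- `H` agrees with the formula on the open slice
  have hev : (fun y' : E3 ↦ scalarH M a (E4.ofTimeSpace 0 y')) =ᶠ[𝓝 y]
      fun y' ↦ M * radius a (E4.ofTimeSpace 0 y') * (blSigma a y')⁻¹ := by
    filter_upwards [(slice a ρ).isOpen.mem_nhds hy] with y' hy'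
    rw [scalarH_ofTimeSpace_eq 0 (radius_pos_of_mem_slice hy'), div_eq_mul_inv]
  refine ⟨_, hform.congr_of_eventuallyEq hev, ?_⟩
  -- the norm bound
  have hr2 : 0 < r ^ 2 := by positivity
  have hSginv : (blSigma a y)⁻¹ ≤ (r ^ 2)⁻¹ := by
    rw [inv_le_inv₀ hSgpos hr2]; exact hSgr
  have hSginv2 : (blSigma a y ^ 2)⁻¹ ≤ (r ^ 4)⁻¹ := by
    rw [inv_le_inv₀ (by positivity) (by positivity)]
    nlinarith
  have hA : ‖(M * r) • ((-(blSigma a y ^ 2)⁻¹) • ((2 : ℝ) • (r • radiusGrad a y + r • radiusGrad a y)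
      - 2 • (innerSL ℝ y : E3 →L[ℝ] ℝ)))‖ ≤ M * r * ((r ^ 4)⁻¹ * (4 * r * K + 2 * (r + |a|))) := by
    rw [norm_smul, norm_smul, Real.norm_eq_abs, Real.norm_eq_abs, abs_of_nonneg (by positivity),
      abs_neg, abs_of_pos (by positivity)]
    exact mul_le_mul_of_nonneg_left (mul_le_mul hSginv2 hSgn (norm_nonneg _) (by positivity))
      (by positivity)
  have hB : ‖(blSigma a y)⁻¹ • (M • radiusGrad a y)‖ ≤ (r ^ 2)⁻¹ * (M * K) := by
    rw [norm_smul, norm_smul, Real.norm_eq_abs, Real.norm_eq_abs, abs_of_pos (inv_pos.2 hSgpos),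
      abs_of_nonneg hM]
    exact mul_le_mul hSginv (mul_le_mul_of_nonneg_left hdrn hM) (by positivity) (by positivity)
  have hsum := (norm_add_le _ _).trans (add_le_add hA hB)
  refine hsum.trans ?_
  -- `M r (4 r K + 2(r + |a|))/r⁴ + M K/r² = M (5K + 2 + 2|a|/r)/r² ≤ M (5K + 2 + 2|a|/ρ)/ρ²`
  have hrρ : ρ ≤ r := hρr.le
  have h1 : M * r * ((r ^ 4)⁻¹ * (4 * r * K + 2 * (r + |a|))) + (r ^ 2)⁻¹ * (M * K) =
      M * (5 * K + 2 + 2 * |a| / r) / r ^ 2 := by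
    field_simp
    ring
  rw [h1]
  have hnum : 5 * K + 2 + 2 * |a| / r ≤ 5 * K + 2 + 2 * |a| / ρ := by
    have : 2 * |a| / r ≤ 2 * |a| / ρ := div_le_div_of_nonneg_left (by positivity) hρ hrρ
    linarith
  have hnum0 : 0 ≤ 5 * K + 2 + 2 * |a| / r := by positivity
  calc M * (5 * K + 2 + 2 * |a| / r) / r ^ 2
      ≤ M * (5 * K + 2 + 2 * |a| / ρ) / r ^ 2 := by gcongr
    _ ≤ M * (5 * K + 2 + 2 * |a| / ρ) / ρ ^ 2 := by
        apply div_le_div_of_nonneg_left (by positivity) (by positivity)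
        exact pow_le_pow_left₀ hρ.le hrρ 2

/-- On the slice `{r > ρ}`, `ρ > 0`, the radial cutoff `y ↦ χ_{r₀}(r(0, y))` is differentiable
with `‖D(χ∘r)‖ ≤ C_σ · |2/r₀| · (1 + |a|/ρ)`, `C_σ` a bound for `|σ'|`. [folklore] -/
theorem exists_hasFDerivAt_innerCutoff_radius_slice (r₀ : ℝ) (hρ : 0 < ρ) (hy : y ∈ slice a ρ)
    {Cσ : ℝ} (hCσ : ∀ s, |deriv Real.smoothTransition s| ≤ Cσ) :
    ∃ χ' : E3 →L[ℝ] ℝ, HasFDerivAt (fun y ↦ innerCutoff r₀ (radius a (E4.ofTimeSpace 0 y))) χ' y ∧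
      ‖χ'‖ ≤ Cσ * |2 / r₀| * (1 + |a| / ρ) := by
  have hr : 0 < radius a (E4.ofTimeSpace 0 y) := radius_pos_of_mem_slice hy
  have hdr := hasFDerivAt_radius_slice hr
  have hdrn : ‖radiusGrad a y‖ ≤ 1 + |a| / ρ := norm_radiusGrad_le hρ hy
  have h := (hasDerivAt_innerCutoff r₀ (radius a (E4.ofTimeSpace 0 y))).comp_hasFDerivAt y hdr
  refine ⟨_, h, ?_⟩
  rw [norm_smul, Real.norm_eq_abs, abs_mul]
  have hC0 : 0 ≤ Cσ := (abs_nonneg _).trans (hCσ 0)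
  exact mul_le_mul (mul_le_mul_of_nonneg_right (hCσ _) (abs_nonneg _)) hdrn (norm_nonneg _)
    (by positivity)

/-- On the slice `{r > ρ}`, `ρ > 0`, the cutoff profile `y ↦ φ(0, y) = 2χ(r)H` of the surgered
background is differentiable with
`‖Dφ‖ ≤ 2 · M (5(1 + |a|/ρ) + 2 + 2|a|/ρ)/ρ² + 2 (M/ρ) · C_σ |2/r₀| (1 + |a|/ρ)`.
[cite: KerrSchild1965, §2] -/
theorem exists_hasFDerivAt_surgeryProfile_slice (hM : 0 ≤ M) (r₀ : ℝ) (hρ : 0 < ρ)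
    (hy : y ∈ slice a ρ) {Cσ : ℝ} (hCσ : ∀ s, |deriv Real.smoothTransition s| ≤ Cσ) :
    ∃ φ' : E3 →L[ℝ] ℝ, HasFDerivAt (fun y ↦ surgeryProfile M a r₀ (E4.ofTimeSpace 0 y)) φ' y ∧
      ‖φ'‖ ≤ 2 * (M * (5 * (1 + |a| / ρ) + 2 + 2 * |a| / ρ) / ρ ^ 2) +
        2 * (M / ρ) * (Cσ * |2 / r₀| * (1 + |a| / ρ)) := by
  have hr : 0 < radius a (E4.ofTimeSpace 0 y) := radius_pos_of_mem_slice hy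
  have hρr : ρ < radius a (E4.ofTimeSpace 0 y) := lt_radius_of_mem_slice hy
  obtain ⟨H', hH, hHn⟩ := exists_hasFDerivAt_scalarH_slice hM hρ hy
  obtain ⟨χ', hχ, hχn⟩ := exists_hasFDerivAt_innerCutoff_radius_slice r₀ hρ hy hCσ
  have h := (hχ.const_mul (2 : ℝ)).mul hH
  refine ⟨_, h, ?_⟩
  -- `|2χ| ≤ 2`, `|H| ≤ M/r ≤ M/ρ`
  have hχ1 : |2 * innerCutoff r₀ (radius a (E4.ofTimeSpace 0 y))| ≤ 2 := by
    rw [abs_mul, abs_two, abs_of_nonneg (innerCutoff_nonneg _ _)]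
    linarith [innerCutoff_le_one r₀ (radius a (E4.ofTimeSpace 0 y))]
  have hHval : |scalarH M a (E4.ofTimeSpace 0 y)| ≤ M / ρ := by
    rw [abs_of_nonneg (scalarH_nonneg hM a _)]
    exact (scalarH_le_div hM a hr).trans (div_le_div_of_nonneg_left hM hρ hρr.le)
  have hC0 : 0 ≤ Cσ := (abs_nonneg _).trans (hCσ 0)
  calc ‖(2 * innerCutoff r₀ (radius a (E4.ofTimeSpace 0 y))) • H' +
        scalarH M a (E4.ofTimeSpace 0 y) • ((2 : ℝ) • χ')‖
      ≤ ‖(2 * innerCutoff r₀ (radius a (E4.ofTimeSpace 0 y))) • H'‖ +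
        ‖scalarH M a (E4.ofTimeSpace 0 y) • ((2 : ℝ) • χ')‖ := norm_add_le _ _
    _ ≤ 2 * (M * (5 * (1 + |a| / ρ) + 2 + 2 * |a| / ρ) / ρ ^ 2) +
        (M / ρ) * (2 * (Cσ * |2 / r₀| * (1 + |a| / ρ))) := by
        refine add_le_add ?_ ?_
        · rw [norm_smul, Real.norm_eq_abs]
          exact mul_le_mul hχ1 hHn (norm_nonneg _) zero_le_two
        · rw [norm_smul, norm_smul, Real.norm_eq_abs, Real.norm_eq_abs, abs_two]
          exact mul_le_mul hHval (mul_le_mul_of_nonneg_left hχn zero_le_two) (by positivity)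
            (by positivity)
    _ = _ := by ring

/-- On the slice `{r > ρ}`, `ρ > 0`, every component `y ↦ ℓ^κ(0, y)` of the null vector is
differentiable with `‖Dℓ^κ‖ ≤ (21 (1 + |a|/ρ) + 5)/ρ` (`ℓ⁰ = −1` is constant; the spatial
components are those of `ℓ⃗`, `Kerr.exists_hasFDerivAt_nullSpatial_slice`).
[cite: arXiv07060622, (34)] -/
theorem exists_hasFDerivAt_nullVector_apply_slice (hρ : 0 < ρ) (hy : y ∈ slice a ρ) (κ : Fin 4) :
    ∃ L : E3 →L[ℝ] ℝ, HasFDerivAt (fun y ↦ nullVector a (E4.ofTimeSpace 0 y) κ) L y ∧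
      ‖L‖ ≤ (21 * (1 + |a| / ρ) + 5) / ρ := by
  have hL0 : 0 ≤ (21 * (1 + |a| / ρ) + 5) / ρ := by positivity
  refine Fin.cases ?_ (fun i ↦ ?_) κ
  · refine ⟨0, ?_, by simpa using hL0⟩
    have h : (fun y : E3 ↦ nullVector a (E4.ofTimeSpace 0 y) 0) = fun _ ↦ (-1 : ℝ) :=
      funext fun y ↦ nullVector_apply_zero a _
    rw [h]
    exact hasFDerivAt_const _ _
  · obtain ⟨L', hL', hL'n⟩ := exists_hasFDerivAt_nullSpatial_slice hρ hy
    have hfun : (fun y : E3 ↦ nullVector a (E4.ofTimeSpace 0 y) i.succ) =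
        (EuclideanSpace.proj i : E3 →L[ℝ] ℝ) ∘ fun y ↦ nullSpatial a (E4.ofTimeSpace 0 y) := by
      funext y'
      simp only [Function.comp_apply, PiLp.proj_apply, nullSpatial_apply, nullVector_apply,
        Fin.succ_ne_zero, if_false, one_mul]
    refine ⟨(EuclideanSpace.proj i : E3 →L[ℝ] ℝ).comp L', ?_, ?_⟩
    · rw [hfun]
      exact (EuclideanSpace.proj (𝕜 := ℝ) i).hasFDerivAt.comp y hL'
    · calc ‖(EuclideanSpace.proj i : E3 →L[ℝ] ℝ).comp L'‖
          ≤ ‖(EuclideanSpace.proj i : E3 →L[ℝ] ℝ)‖ * ‖L'‖ := ContinuousLinearMap.opNorm_comp_le _ _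
        _ ≤ 1 * ((21 * (1 + |a| / ρ) + 5) / ρ) :=
            mul_le_mul (norm_proj_le_one i) hL'n (norm_nonneg _) zero_le_one
        _ = _ := one_mul _

end Slice

/-! ### The global bound -/

/-- The **explicit (unoptimised) bound for `|∂g⁻¹|` of the surgered background** in terms of
`M`, `a`, `r₀` and a bound `C_σ` for the derivative of the cutoff: with `ρ = r₀/4`,
`K = 1 + |a|/ρ`, `L = (21K + 5)/ρ`, `Φ = 4M/r₀`,
`D = 2 Φ L + 2 M (5K + 2 + 2|a|/ρ)/ρ² + 2 (M/ρ) C_σ |2/r₀| K`. [folklore] -/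
def surgeryDerivBound (M a r₀ Cσ : ℝ) : ℝ :=
  2 * (4 * M / r₀) * ((21 * (1 + |a| / (r₀ / 4)) + 5) / (r₀ / 4)) +
    (2 * (M * (5 * (1 + |a| / (r₀ / 4)) + 2 + 2 * |a| / (r₀ / 4)) / (r₀ / 4) ^ 2) +
      2 * (M / (r₀ / 4)) * (Cσ * |2 / r₀| * (1 + |a| / (r₀ / 4))))

/-- `surgeryDerivBound ≥ 0` for `M ≥ 0`, `r₀ > 0`, `C_σ ≥ 0`. [folklore] -/
theorem surgeryDerivBound_nonneg {M r₀ Cσ : ℝ} (hM : 0 ≤ M) (a : ℝ) (hr₀ : 0 < r₀) (hC : 0 ≤ Cσ) :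
    0 ≤ surgeryDerivBound M a r₀ Cσ := by
  unfold surgeryDerivBound
  positivity

/-- **The leaf components of the surgered background have uniformly bounded derivative**: for
every `y ∈ E3` there is `L` with `HasFDerivAt (y ↦ g^{αβ}(0, y)) L y` and
`‖L‖ ≤ surgeryDerivBound M a r₀ C_σ`. Inside `{r < r₀/2}` the profile vanishes identically and
`L = 0`; on `{r > r₀/4}` use the slice bounds. [cite: KerrSchild1965, §2] -/
theorem exists_hasFDerivAt_surgery_leaf {M : ℝ} (hM : 0 ≤ M) (a : ℝ) {r₀ : ℝ} (hr₀ : 0 < r₀)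
    {Cσ : ℝ} (hCσ : ∀ s, |deriv Real.smoothTransition s| ≤ Cσ) (α β : Fin 4) (y : E3) :
    ∃ L : E3 →L[ℝ] ℝ,
      HasFDerivAt (fun y ↦ (surgeryBackground M a r₀ hM hr₀).inverseMetric (E4.ofTimeSpace 0 y) α β)
        L y ∧ ‖L‖ ≤ surgeryDerivBound M a r₀ Cσ := by
  have hC0 : 0 ≤ Cσ := (abs_nonneg _).trans (hCσ 0)
  have hD0 := surgeryDerivBound_nonneg hM a hr₀ hC0
  -- the leaf component, unfolded
  have hcomp : (fun y : E3 ↦ (surgeryBackground M a r₀ hM hr₀).inverseMetric (E4.ofTimeSpace 0 y) α β)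
      = fun y ↦ etaComp α β - surgeryProfile M a r₀ (E4.ofTimeSpace 0 y) *
          nullVector a (E4.ofTimeSpace 0 y) α * nullVector a (E4.ofTimeSpace 0 y) β := by
    funext y'
    simp only [KerrSchild.Background.inverseMetric, surgeryBackground_φ, surgeryBackground_l,
      KerrSchild.inverseMetric]
  rw [hcomp]
  by_cases hcase : radius a (E4.ofTimeSpace 0 y) < r₀ / 2
  · -- ### inside: the profile vanishes near `y`
    have hO : IsOpen {y' : E3 | radius a (E4.ofTimeSpace 0 y') < r₀ / 2} :=
      isOpen_lt ((continuous_radius a).comp (E4.continuous_ofTimeSpace 0)) continuous_const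
    have hev : (fun y' : E3 ↦ etaComp α β - surgeryProfile M a r₀ (E4.ofTimeSpace 0 y') *
        nullVector a (E4.ofTimeSpace 0 y') α * nullVector a (E4.ofTimeSpace 0 y') β) =ᶠ[𝓝 y]
        fun _ ↦ etaComp α β := by
      filter_upwards [hO.mem_nhds hcase] with y' hy'
      rw [surgeryProfile_eq_zero_of_le hr₀ (le_of_lt hy'), zero_mul, zero_mul, sub_zero]
    exact ⟨0, (hasFDerivAt_const _ _).congr_of_eventuallyEq hev, by simpa using hD0⟩
  · -- ### on the slice `{r > r₀/4}`
    set ρ : ℝ := r₀ / 4 with hρdef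
    have hρ : 0 < ρ := by positivity
    have hyρ : y ∈ slice a ρ := by
      rw [mem_slice, max_eq_left hρ.le]
      have : r₀ / 4 < r₀ / 2 := by linarith
      exact this.trans_le (not_lt.1 hcase)
    have hr : 0 < radius a (E4.ofTimeSpace 0 y) := radius_pos_of_mem_slice hyρ
    obtain ⟨φ', hφ, hφn⟩ := exists_hasFDerivAt_surgeryProfile_slice hM r₀ hρ hyρ hCσ
    obtain ⟨Lα, hLα, hLαn⟩ := exists_hasFDerivAt_nullVector_apply_slice hρ hyρ α
    obtain ⟨Lβ, hLβ, hLβn⟩ := exists_hasFDerivAt_nullVector_apply_slice hρ hyρ β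
    have h := ((hφ.mul hLα).mul hLβ).const_sub (etaComp α β)
    refine ⟨_, h, ?_⟩
    -- sizes of the values
    have hφv : |surgeryProfile M a r₀ (E4.ofTimeSpace 0 y)| ≤ 4 * M / r₀ := by
      rw [abs_of_nonneg (surgeryProfile_nonneg hM a r₀ _)]
      exact surgeryProfile_le hM a hr₀ _
    have hlv : ∀ κ, |nullVector a (E4.ofTimeSpace 0 y) κ| ≤ 1 := fun κ ↦ abs_nullVector_le_one hr κ
    set Lbd : ℝ := (21 * (1 + |a| / ρ) + 5) / ρ with hLbd
    have hLbd0 : 0 ≤ Lbd := by positivity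
    set Φ₀ : ℝ := 4 * M / r₀ with hΦ₀
    have hΦ₀0 : 0 ≤ Φ₀ := by positivity
    set φv := surgeryProfile M a r₀ (E4.ofTimeSpace 0 y) with hφvdef
    set lα := nullVector a (E4.ofTimeSpace 0 y) α with hlαdef
    set lβ := nullVector a (E4.ofTimeSpace 0 y) β with hlβdef
    -- `‖−[(φ lα) • Lβ + lβ • (φ • Lα + lα • φ')]‖ ≤ Φ₀ L + (Φ₀ L + ‖φ'‖)`
    have hn : ‖-((φv * lα) • Lβ + lβ • (φv • Lα + lα • φ'))‖ ≤ Φ₀ * Lbd + (Φ₀ * Lbd + ‖φ'‖) := by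
      rw [norm_neg]
      refine (norm_add_le _ _).trans (add_le_add ?_ ?_)
      · rw [norm_smul, Real.norm_eq_abs, abs_mul]
        exact mul_le_mul (by nlinarith [hφv, hlv α, abs_nonneg φv, abs_nonneg lα]) hLβn
          (norm_nonneg _) hΦ₀0
      · rw [norm_smul, Real.norm_eq_abs]
        have hin : ‖φv • Lα + lα • φ'‖ ≤ Φ₀ * Lbd + ‖φ'‖ := by
          refine (norm_add_le _ _).trans (add_le_add ?_ ?_)
          · rw [norm_smul, Real.norm_eq_abs]
            exact mul_le_mul hφv hLαn (norm_nonneg _) hΦ₀0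
          · rw [norm_smul, Real.norm_eq_abs]
            calc |lα| * ‖φ'‖ ≤ 1 * ‖φ'‖ := mul_le_mul_of_nonneg_right (hlv α) (norm_nonneg _)
              _ = ‖φ'‖ := one_mul _
        calc |lβ| * ‖φv • Lα + lα • φ'‖ ≤ 1 * (Φ₀ * Lbd + ‖φ'‖) :=
              mul_le_mul (hlv β) hin (norm_nonneg _) zero_le_one
          _ = Φ₀ * Lbd + ‖φ'‖ := one_mul _
    refine hn.trans ?_
    have : Φ₀ * Lbd + (Φ₀ * Lbd + ‖φ'‖) ≤ 2 * Φ₀ * Lbd +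
        (2 * (M * (5 * (1 + |a| / ρ) + 2 + 2 * |a| / ρ) / ρ ^ 2) +
          2 * (M / ρ) * (Cσ * |2 / r₀| * (1 + |a| / ρ))) := by linarith
    exact this.trans (le_of_eq (by rw [hΦ₀, hLbd, hρdef, surgeryDerivBound]))

/-- **Uniform `C¹` bound for the surgered Kerr–Schild background**: for `M ≥ 0`, any `a` and
`r₀ > 0` there is `D ≥ 0` with `|∂_μ g^{αβ}(x)| ≤ D` for all `x ∈ ℝ⁴` and all indices, where
`g⁻¹ = η⁻¹ − φ ℓ♯ ⊗ ℓ♯` is the inverse metric of `Kerr.surgeryBackground M a r₀`. By stationarity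
the derivative is that of the leaf function along `x⃗(∂_μ)`, of norm `≤ 1`
(`exists_hasFDerivAt_surgery_leaf`). This is the uniformity hypothesis (`|∇N|`, `∇g` bounded)
under which energy estimates on the Kerr exterior hold with constants independent of the support
of the data (Sbierski, Anal. PDE 8 (2015), Thm. 2.1, condition (2.2)). [cite: KerrSchild1965, §2] -/
theorem exists_bound_fderiv_surgeryBackground_inverseMetric {M : ℝ} (hM : 0 ≤ M) (a : ℝ)
    {r₀ : ℝ} (hr₀ : 0 < r₀) :
    ∃ D : ℝ, 0 ≤ D ∧ ∀ (x : E4) (μ α β : Fin 4),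
      |fderiv ℝ (fun z ↦ (surgeryBackground M a r₀ hM hr₀).inverseMetric z α β) x
        (E4.basisVector μ)| ≤ D := by
  obtain ⟨Cσ, hC0, hCσ⟩ := exists_bound_deriv_smoothTransition
  refine ⟨surgeryDerivBound M a r₀ Cσ, surgeryDerivBound_nonneg hM a hr₀ hC0, fun x μ α β ↦ ?_⟩
  set gL : E3 → ℝ := fun y ↦
    (surgeryBackground M a r₀ hM hr₀).inverseMetric (E4.ofTimeSpace 0 y) α β with hgL
  have hleaf : (fun z ↦ (surgeryBackground M a r₀ hM hr₀).inverseMetric z α β) = gL ∘ E4.spatial :=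
    funext fun z ↦ surgeryBackground_inverseMetric_eq_leaf hM a hr₀ z α β
  obtain ⟨L, hL, hLn⟩ := exists_hasFDerivAt_surgery_leaf hM a hr₀ hCσ α β (E4.spatial x)
  rw [hleaf, (hL.comp x E4.spatial.hasFDerivAt).fderiv, ContinuousLinearMap.comp_apply]
  -- `‖x⃗(v)‖ ≤ ‖v‖` and `‖∂_μ‖ = 1`
  have hsp : ‖E4.spatial (E4.basisVector μ)‖ ≤ 1 := by
    have hle : E4.spatialNorm (E4.basisVector μ) ^ 2 ≤ 1 := by
      rw [E4.spatialNorm_sq]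
      fin_cases μ <;> simp [E4.basisVector]
    have h0 : 0 ≤ E4.spatialNorm (E4.basisVector μ) := E4.spatialNorm_nonneg _
    show E4.spatialNorm (E4.basisVector μ) ≤ 1
    nlinarith
  calc |L (E4.spatial (E4.basisVector μ))| = ‖L (E4.spatial (E4.basisVector μ))‖ :=
        (Real.norm_eq_abs _).symm
    _ ≤ ‖L‖ * ‖E4.spatial (E4.basisVector μ)‖ := L.le_opNorm _
    _ ≤ surgeryDerivBound M a r₀ Cσ * 1 :=
        mul_le_mul hLn hsp (norm_nonneg _) (surgeryDerivBound_nonneg hM a hr₀ hC0)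
    _ = surgeryDerivBound M a r₀ Cσ := mul_one _

end Literature.Geometry.Lorentzian.Kerr

end
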